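import Summits.QuantumAdvantage.QuantumAdvantage.Theorems.CubicForrelationNearExactIsExactTwelvePartnerR2Blocks
import Summits.QuantumAdvantage.QuantumAdvantage.Theorems.CubicForrelationNearExactIsExactTwelvePartnerR4Blocks
import Summits.QuantumAdvantage.QuantumAdvantage.Theorems.CubicForrelationNearExactIsExactTwelvePartnerLeaves
import Summits.QuantumAdvantage.QuantumAdvantage.Theorems.CubicForrelationNearExactIsExactTwelvePartnerTrace

/-!
# Crux `CubicForrelation.NearExactIsExact` (stmt-QuantumAdvantage-14043) — n = 12, E1280-even, R2 leaf s₀ω₈ ASSEMBLED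
  (E1280-HANDPROOFS.md §1.3): frame data + light structure + pairing partner ⇒ contradiction (parity of the number of hyperbolic pairs)

Certificate seat `b2b-cforr-cert` (gen 39).  HONEST FRAMING: kernel-checked (standard axioms) end-to-end version of the leaf s₀ω₈ in the
coefficient-tensor language.  The descendant is `t̄ = s₀ ∧ ω`, `ω = Σ_{q<4} s_{lo q} ∧ s_{hi q}` (four hyperbolic pairs covering the eight
coordinates other than `s₀ = z0`): hypotheses `hT` (the slice at `s₀`), `hlo`/`hhi` (the slices at `s_{lo q}`, `s_{hi q}`), `hcover`, the
order facts, and the LIGHT STRUCTURE `G = ε·ι_{s₀}t̄ + s₀∧g`, `Γ = ε′·ι_{s₀}t̄ + s₀∧γ`.  Derivation: (E2) ⇒ `A_{s₀,·} = B_{s₀,·} = 0` and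
`⟨A,ω⟩ = ⟨B,ω⟩ = 0`; (E3) at `(s₀,s₀)` ⇒ `⟨K,ω⟩ = 1` (`K = ι_{s₀}c_S`); (E3) at `(s_{lo q}, s_{lo q})` ⇒ `εA + ε′B + K = 1` on each pair;
summing over the FOUR pairs gives `⟨K,ω⟩ = 4 = 0`.  Contradiction (`tpl_R2_w8_core` is this computation in matrix form; here it is inlined).
NOT summit progress.
-/

set_option linter.dupNamespace false -- D-0017: single-problem summit ⇒ `QuantumAdvantage.QuantumAdvantage` by design

namespace Summit.QuantumAdvantage.QuantumAdvantage.Theorems.CubicForrelation.NearExactIsExact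

open Finset Matrix

/-- Pairing against a sum of four basis wedges. [this work] -/
theorem tpa_pair_four_wedges {n : ℕ} (X : Fin n → Fin n → ZMod 2) (lo hi : Fin 4 → Fin n) (hlt : ∀ q, lo q < hi q) :
    (∑ s, ∑ t, (if s < t then X s t * (∑ q, (if (s = lo q ∧ t = hi q) ∨ (s = hi q ∧ t = lo q) then (1 : ZMod 2) else 0)) else 0)) =
      ∑ q, X (lo q) (hi q) := by
  have hterm : ∀ s t, (if s < t then X s t * (∑ q, (if (s = lo q ∧ t = hi q) ∨ (s = hi q ∧ t = lo q) then (1 : ZMod 2) else 0)) else 0) =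
      ∑ q, (if s < t then X s t * (if (s = lo q ∧ t = hi q) ∨ (s = hi q ∧ t = lo q) then 1 else 0) else 0) := by
    intro s t
    by_cases h : s < t
    · simp only [h, if_true, Finset.mul_sum]
    · simp only [h, if_false, Finset.sum_const_zero]
  rw [Finset.sum_congr rfl fun s _ => Finset.sum_congr rfl fun t _ => hterm s t]
  rw [Finset.sum_congr rfl fun s _ => Finset.sum_comm, Finset.sum_comm]
  exact Finset.sum_congr rfl fun q _ => tpc4_pair_basis_wedge X (lo q) (hi q) (hlt q)

/-- **R2 leaf s₀ω₈, assembled.** [this work] -/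
theorem tpa_R2_w8 (c d : Fin (3 + 9) → Fin (3 + 9) → Fin (3 + 9) → ZMod 2)
    (hcs : ∀ p j k, c p k j = c p j k) (hcc : ∀ p j k, c j p k = c p j k) (hcd : ∀ p j, c p j j = 0)
    (hds : ∀ φ j k, d φ k j = d φ j k) (hdc : ∀ φ j k, d j φ k = d φ j k) (hdd : ∀ φ j, d φ j j = 0)
    (hpair : ∀ p φ, (∑ j, ∑ k, (if j < k then c p j k * d φ j k else 0)) = if p = φ then 1 else 0)
    (hF1 : ∀ j k, d (Fin.castAdd 9 0) j k =
      if (j = Fin.castAdd 9 1 ∧ k = Fin.castAdd 9 2) ∨ (j = Fin.castAdd 9 2 ∧ k = Fin.castAdd 9 1) then 1 else 0)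
    (z0 : Fin 9) (lo hi : Fin 4 → Fin 9) (hzlo : ∀ q, z0 < lo q) (hzhi : ∀ q, z0 < hi q) (hlohi : ∀ q, lo q < hi q)
    (hlolo : ∀ q q', lo q = lo q' → q = q') (hlohi' : ∀ q q', lo q ≠ hi q')
    (hcover : ∀ x : Fin 9, x = z0 ∨ ∃ q, x = lo q ∨ x = hi q)
    (hT : ∀ s u : Fin 9, d (Fin.natAdd 3 z0) (Fin.natAdd 3 s) (Fin.natAdd 3 u) =
      ∑ q, (if (s = lo q ∧ u = hi q) ∨ (s = hi q ∧ u = lo q) then (1 : ZMod 2) else 0))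
    (hlo : ∀ q (s u : Fin 9), d (Fin.natAdd 3 (lo q)) (Fin.natAdd 3 s) (Fin.natAdd 3 u) =
      if (s = z0 ∧ u = hi q) ∨ (s = hi q ∧ u = z0) then 1 else 0)
    (hhi : ∀ q (s u : Fin 9), d (Fin.natAdd 3 (hi q)) (Fin.natAdd 3 s) (Fin.natAdd 3 u) =
      if (s = z0 ∧ u = lo q) ∨ (s = lo q ∧ u = z0) then 1 else 0)
    (ε ε' : ZMod 2) (g γ : Fin 9 → ZMod 2)
    (hG : ∀ s t : Fin 9, d (Fin.castAdd 9 1) (Fin.natAdd 3 s) (Fin.natAdd 3 t) =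
      ε * d (Fin.natAdd 3 z0) (Fin.natAdd 3 s) (Fin.natAdd 3 t) + (if s = z0 then g t else 0) + (if t = z0 then g s else 0))
    (hΓ : ∀ s t : Fin 9, d (Fin.castAdd 9 2) (Fin.natAdd 3 s) (Fin.natAdd 3 t) =
      ε' * d (Fin.natAdd 3 z0) (Fin.natAdd 3 s) (Fin.natAdd 3 t) + (if s = z0 then γ t else 0) + (if t = z0 then γ s else 0)) :
    False := by
  set A : Fin 9 → Fin 9 → ZMod 2 := fun s t => c (Fin.castAdd 9 1) (Fin.natAdd 3 s) (Fin.natAdd 3 t) with hA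
  set B : Fin 9 → Fin 9 → ZMod 2 := fun s t => c (Fin.castAdd 9 2) (Fin.natAdd 3 s) (Fin.natAdd 3 t) with hB
  set K : Fin 9 → Fin 9 → ZMod 2 := fun s t => c (Fin.natAdd 3 z0) (Fin.natAdd 3 s) (Fin.natAdd 3 t) with hK
  have hAs : ∀ s t, A t s = A s t := fun s t => hcs _ _ _
  have hBs : ∀ s t, B t s = B s t := fun s t => hcs _ _ _
  have hE2A := fun f => (tpb_E2 c d hcs hcc hcd hds hdc hdd hpair hF1 f).1
  have hE2B := fun f => (tpb_E2 c d hcs hcc hcd hds hdc hdd hpair hF1 f).2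
  have hE3 := tpb_E3 c d hcs hcc hds hdc hdd hpair hF1
  -- (E2) at the slices `lo q`, `hi q`: `A(z0, ·) = 0`, `B(z0, ·) = 0`
  have hAz : ∀ x, A z0 x = 0 := by
    intro x
    rcases hcover x with rfl | ⟨q, rfl | rfl⟩
    · exact hcd _ _
    · have h := hE2A (hi q); simp only [hhi] at h; rwa [tpc4_pair_basis_wedge _ _ _ (hzlo q)] at h
    · have h := hE2A (lo q); simp only [hlo] at h; rwa [tpc4_pair_basis_wedge _ _ _ (hzhi q)] at h
  have hBz : ∀ x, B z0 x = 0 := by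
    intro x
    rcases hcover x with rfl | ⟨q, rfl | rfl⟩
    · exact hcd _ _
    · have h := hE2B (hi q); simp only [hhi] at h; rwa [tpc4_pair_basis_wedge _ _ _ (hzlo q)] at h
    · have h := hE2B (lo q); simp only [hlo] at h; rwa [tpc4_pair_basis_wedge _ _ _ (hzhi q)] at h
  -- (E2) at the slice `z0`: `Σ_q A(lo q, hi q) = 0`, same for `B`
  have hAω : (∑ q, A (lo q) (hi q)) = 0 := by
    have h := hE2A z0; simp only [hT] at h; rwa [tpa_pair_four_wedges _ lo hi hlohi] at h
  have hBω : (∑ q, B (lo q) (hi q)) = 0 := by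
    have h := hE2B z0; simp only [hT] at h; rwa [tpa_pair_four_wedges _ lo hi hlohi] at h
  -- the slice at z0, row `lo q`: `T(lo q, s) = [s = hi q]`; row z0: 0
  have hTlo : ∀ q s, d (Fin.natAdd 3 z0) (Fin.natAdd 3 (lo q)) (Fin.natAdd 3 s) = if s = hi q then 1 else 0 := by
    intro q s
    rw [hT, Finset.sum_eq_single q]
    · by_cases hs : s = hi q
      · rw [if_pos hs, if_pos (Or.inl ⟨rfl, hs⟩)]
      · rw [if_neg hs, if_neg]
        rintro (⟨-, h⟩ | ⟨h, -⟩)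
        · exact hs h
        · exact hlohi' q q h
    · intro q' _ hq'
      rw [if_neg]
      rintro (⟨h, -⟩ | ⟨h, -⟩)
      · exact hq' (hlolo q q' h).symm
      · exact hlohi' q q' h
    · intro h0; exact absurd (Finset.mem_univ _) h0
  have hTz : ∀ s, d (Fin.natAdd 3 z0) (Fin.natAdd 3 z0) (Fin.natAdd 3 s) = 0 :=
    fun s => (tpb_diag12 d hds hdc hdd _ _).1
  have hloz : ∀ q, lo q ≠ z0 := fun q h => lt_irrefl _ (h ▸ hzlo q)
  -- (E3) at (z0, z0): `⟨K, ω⟩ = Σ_q K(lo q, hi q) = 1`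
  have hK1 : (∑ q, K (lo q) (hi q)) = 1 := by
    have h := hE3 z0 z0
    rw [if_pos rfl] at h
    have h1 : (∑ s, (d (Fin.castAdd 9 1) (Fin.natAdd 3 z0) (Fin.natAdd 3 s) * c (Fin.castAdd 9 1) (Fin.natAdd 3 s) (Fin.natAdd 3 z0) +
        d (Fin.castAdd 9 2) (Fin.natAdd 3 z0) (Fin.natAdd 3 s) * c (Fin.castAdd 9 2) (Fin.natAdd 3 s) (Fin.natAdd 3 z0))) = 0 :=
      Finset.sum_eq_zero fun s _ => by
        rw [show c (Fin.castAdd 9 1) (Fin.natAdd 3 s) (Fin.natAdd 3 z0) = A z0 s from hAs z0 s, hAz,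
          show c (Fin.castAdd 9 2) (Fin.natAdd 3 s) (Fin.natAdd 3 z0) = B z0 s from hBs z0 s, hBz, mul_zero, mul_zero, add_zero]
    rw [h1, zero_add] at h
    simp only [hT] at h
    rwa [tpa_pair_four_wedges _ lo hi hlohi] at h
  -- (E3) at (lo q, lo q): `ε A(lo q, hi q) + ε′ B(lo q, hi q) + K(lo q, hi q) = 1`
  have hdiag : ∀ q, ε * A (lo q) (hi q) + ε' * B (lo q) (hi q) + K (lo q) (hi q) = 1 := by
    intro q
    have h := hE3 (lo q) (lo q)
    rw [if_pos rfl] at h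
    have hτ : (∑ s, ∑ t, (if s < t then c (Fin.natAdd 3 (lo q)) (Fin.natAdd 3 s) (Fin.natAdd 3 t) *
        d (Fin.natAdd 3 (lo q)) (Fin.natAdd 3 s) (Fin.natAdd 3 t) else 0)) = K (lo q) (hi q) := by
      simp only [hlo]
      rw [tpc4_pair_basis_wedge _ _ _ (hzhi q)]
      show c (Fin.natAdd 3 (lo q)) (Fin.natAdd 3 z0) (Fin.natAdd 3 (hi q)) = c (Fin.natAdd 3 z0) (Fin.natAdd 3 (lo q)) (Fin.natAdd 3 (hi q))
      rw [hcc]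
    have hmain : (∑ s, (d (Fin.castAdd 9 1) (Fin.natAdd 3 (lo q)) (Fin.natAdd 3 s) * c (Fin.castAdd 9 1) (Fin.natAdd 3 s) (Fin.natAdd 3 (lo q)) +
        d (Fin.castAdd 9 2) (Fin.natAdd 3 (lo q)) (Fin.natAdd 3 s) * c (Fin.castAdd 9 2) (Fin.natAdd 3 s) (Fin.natAdd 3 (lo q)))) =
        ε * A (lo q) (hi q) + ε' * B (lo q) (hi q) := by
      have hterm : ∀ s, d (Fin.castAdd 9 1) (Fin.natAdd 3 (lo q)) (Fin.natAdd 3 s) * c (Fin.castAdd 9 1) (Fin.natAdd 3 s) (Fin.natAdd 3 (lo q)) +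
          d (Fin.castAdd 9 2) (Fin.natAdd 3 (lo q)) (Fin.natAdd 3 s) * c (Fin.castAdd 9 2) (Fin.natAdd 3 s) (Fin.natAdd 3 (lo q)) =
          if s = hi q then ε * A (lo q) (hi q) + ε' * B (lo q) (hi q) else 0 := by
        intro s
        rw [hG, hΓ, hTlo q s]
        rw [if_neg (hloz q), if_neg (hloz q)]
        by_cases hs : s = hi q
        · have hsz : s ≠ z0 := fun h' => lt_irrefl _ (h' ▸ hs ▸ hzhi q)
          rw [if_pos hs, if_pos hs, if_neg hsz, if_neg hsz, hs,
            show c (Fin.castAdd 9 1) (Fin.natAdd 3 (hi q)) (Fin.natAdd 3 (lo q)) = A (lo q) (hi q) from hAs _ _,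
            show c (Fin.castAdd 9 2) (Fin.natAdd 3 (hi q)) (Fin.natAdd 3 (lo q)) = B (lo q) (hi q) from hBs _ _]
          ring
        · rw [if_neg hs, if_neg hs]
          by_cases hsz : s = z0
          · rw [if_pos hsz, if_pos hsz, hsz,
              show c (Fin.castAdd 9 1) (Fin.natAdd 3 z0) (Fin.natAdd 3 (lo q)) = A z0 (lo q) from rfl, hAz,
              show c (Fin.castAdd 9 2) (Fin.natAdd 3 z0) (Fin.natAdd 3 (lo q)) = B z0 (lo q) from rfl, hBz]
            ring
          · rw [if_neg hsz, if_neg hsz]; ring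
      rw [Finset.sum_congr rfl fun s _ => hterm s, Finset.sum_ite_eq' Finset.univ (hi q), if_pos (Finset.mem_univ _)]
    rw [hmain, hτ] at h
    exact h
  -- sum over the four pairs
  have hsum : (∑ q : Fin 4, (ε * A (lo q) (hi q) + ε' * B (lo q) (hi q) + K (lo q) (hi q))) = ∑ q : Fin 4, (1 : ZMod 2) :=
    Finset.sum_congr rfl fun q _ => hdiag q
  rw [Finset.sum_add_distrib, Finset.sum_add_distrib, ← Finset.mul_sum, ← Finset.mul_sum, hAω, hBω, hK1] at hsum
  revert hsum
  simp only [mul_zero, zero_add, Finset.sum_const, Finset.card_univ, Fintype.card_fin]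
  decide

/-- **R2 leaf `t̄ = 0`, assembled** (E1280-HANDPROOFS §1.0; the matrix core is p384191 `tpc_descendant_zero_obstruction`): with no
descendant the `τ` term of (E3) vanishes and `G A + Γ B = 1₉` for alternating `9 × 9` matrices — impossible by traces. [this work] -/
theorem tpa_R2_zero (c d : Fin (3 + 9) → Fin (3 + 9) → Fin (3 + 9) → ZMod 2)
    (hcs : ∀ p j k, c p k j = c p j k) (hcc : ∀ p j k, c j p k = c p j k)
    (hds : ∀ φ j k, d φ k j = d φ j k) (hdc : ∀ φ j k, d j φ k = d φ j k) (hdd : ∀ φ j, d φ j j = 0)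
    (hpair : ∀ p φ, (∑ j, ∑ k, (if j < k then c p j k * d φ j k else 0)) = if p = φ then 1 else 0)
    (hF1 : ∀ j k, d (Fin.castAdd 9 0) j k =
      if (j = Fin.castAdd 9 1 ∧ k = Fin.castAdd 9 2) ∨ (j = Fin.castAdd 9 2 ∧ k = Fin.castAdd 9 1) then 1 else 0)
    (htb : ∀ f s t : Fin 9, d (Fin.natAdd 3 f) (Fin.natAdd 3 s) (Fin.natAdd 3 t) = 0) : False := by
  have hE3 := tpb_E3 c d hcs hcc hds hdc hdd hpair hF1
  refine tpc_descendant_zero_obstruction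
    (Matrix.of fun f s : Fin 9 => d (Fin.castAdd 9 1) (Fin.natAdd 3 f) (Fin.natAdd 3 s))
    (Matrix.of fun s x : Fin 9 => c (Fin.castAdd 9 1) (Fin.natAdd 3 s) (Fin.natAdd 3 x))
    (Matrix.of fun f s : Fin 9 => d (Fin.castAdd 9 2) (Fin.natAdd 3 f) (Fin.natAdd 3 s))
    (Matrix.of fun s x : Fin 9 => c (Fin.castAdd 9 2) (Fin.natAdd 3 s) (Fin.natAdd 3 x))
    (fun i => hdd _ _) (by ext i j; exact hds _ _ _) (by ext i j; exact hcs _ _ _)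
    (fun i => hdd _ _) (by ext i j; exact hds _ _ _) (by ext i j; exact hcs _ _ _) ?_
  ext f x
  have h := hE3 f x
  have hτ : (∑ s, ∑ t, (if s < t then c (Fin.natAdd 3 x) (Fin.natAdd 3 s) (Fin.natAdd 3 t) *
      d (Fin.natAdd 3 f) (Fin.natAdd 3 s) (Fin.natAdd 3 t) else 0)) = 0 :=
    Finset.sum_eq_zero fun s _ => Finset.sum_eq_zero fun t _ => by rw [htb, mul_zero, ite_self]
  rw [hτ, add_zero] at h
  rw [Matrix.add_apply, Matrix.mul_apply, Matrix.mul_apply, Matrix.one_apply, ← h, ← Finset.sum_add_distrib]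
  rfl

end Summit.QuantumAdvantage.QuantumAdvantage.Theorems.CubicForrelation.NearExactIsExact
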